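import Mathlib
import Summits.Parity.GeneralizedHardyLittlewood.Theorems.FordMaynardSieveConst01651SieveConst01651BilinTools
import Summits.Parity.GeneralizedHardyLittlewood.Theorems.FordMaynardSieveConst01651SieveConst01651TupleLift

/-!
# Route `FordMaynardSieveConst01651`, target `SieveConst01651` (stmt-Parity-19185), line `sieve_decomposition`:
# helpers towards `stub_typeIIRegion` — MONOTONE cross conditions in an INTEGER short variable are exact
# integer thresholds: separation at cost `3(1 + log(2N+4))` each, with NO shells and NO lower bound on the kernel

Ford–Maynard, arXiv:2407.14368v1, §7.1, Lemma 7.9 and the remark after it ("frequently one of `f(n), g(m)` is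
integer valued …"): a condition `[g(z) < f(w)]` between INTEGER valued functions of the two variables of a bilinear
form is removed at the cost of a factor `≪ log x` (tree: `…BilinTools.bilin_threshold_nat`, on top of the
Friedlander–Iwaniec trapezoid transform `BilinBoundedBy.threshold`).  At `P = (1/2, 0, ν)` (`θ = 0`) the Type-II
variable of Proposition 7.19 / 7.22 can be taken to be a SINGLE prime `d` of the smooth part, and then every
entangling condition of the proof of Proposition 7.22 — `d < n^ν`, `P⁻(m) ≥ n^ν`, `P⁺(u') < d`, `u m > n^{1/2}`, and
each face `∑ᵢ aᵢ log pᵢ < b log n` of a polytope cell of `g` (`n = d e`) — is, for a fixed value of the long index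
`z`, a MONOTONE (up-set) or ANTITONE (down-set) condition in the integer `d`; a down-set of `[L, N]` is an initial
segment `{d ≤ G(z)}`, an up-set a final segment `{G(z) < d}`, so each such condition IS an integer threshold and
Lemma 7.9 applies verbatim — no Perron shells (Lemma 7.10), hence no use of the lower bound `w_n ≥ -x^{ν/10}`.
This file records that device in the tree's `BilinBoundedBy` currency:

* `bilin_swap` — the predicate is symmetric in the two variables;
* `bilin_fiberLift_long` — fibre lift on the LONG variable (divisor-bounded fibres `F(z)`, `#F(z) ≤ c(z)`), from
  `…TupleLift.bilin_fiberLift` by swapping;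
* `iff_le_card_of_downset` — a down-set condition on `[L, N]` is `d ≤ L - 1 + #{d' ∈ [L,N] : Q d'}`;
* `bilin_sep_downset` / `bilin_sep_upset` — one antitone / monotone condition costs `3(1 + log(2N+4))`;
* `bilin_sep_finset` — a finite product of such conditions costs `(3(1 + log(2N+4)))^{#s}`;
  `ite_forall_finset_eq_prod` — `𝟙[∀ i ∈ s, Q i] = ∏_{i ∈ s} 𝟙[Q i]`.

Def-free. Nothing here proves anything about the Parity summit; helpers for the Type-II region stub of one leaf.
-/

open Finset Literature.NumberTheory.Sieve.FriedlanderIwaniecPrimes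

namespace Summit.Parity.GeneralizedHardyLittlewood.FordMaynardSieveConst01651SieveConst01651

variable {ι κ : Type*}

/-- `BilinBoundedBy` is symmetric in the two variables (`∑_w ∑_z = ∑_z ∑_w`).
[cite: FriedlanderIwaniecAnnals1998, (21.13)] -/
theorem bilin_swap {K : ι → κ → ℂ} {W : Finset ι} {Z : Finset κ} {X : ℝ}
    (h : BilinBoundedBy K W Z X) : BilinBoundedBy (fun z w => K w z) Z W X := by
  intro b a hb ha
  have hs : ∑ z ∈ Z, ∑ w ∈ W, b z * a w * K w z = ∑ w ∈ W, ∑ z ∈ Z, a w * b z * K w z := by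
    rw [Finset.sum_comm]
    exact Finset.sum_congr rfl fun w _ => Finset.sum_congr rfl fun z _ => by ring
  rw [hs]
  exact h a b ha hb

/-- **Fibre lift on the LONG variable.** If every bilinear form in `c(z) · K(w, z)` over `W × Z` with `1`-bounded
coefficients is `≤ X` (`c ≥ 0` on `Z`; e.g. `c = τ(n)^{B'}` from (II)), and `F z` is a finite set of decorations of
`z` with `#F(z) ≤ c(z)` on `Z` (e.g. pairs of divisors `(m, u')` of `n`, `τ(n)² ≤ τ(n)^{B'}`), then every bilinear
form in the kernel `(w, (z, s)) ↦ K(w, z)` over `W × {(z, s) : z ∈ Z, s ∈ F z}` with `1`-bounded coefficients is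
`≤ X`.  (So the entangling conditions may read any divisor data of the long variable.)
[cite: FordMaynard2024PrimeSieves, §1 (II) (divisor-bounded coefficients) and proof of Proposition 7.22] -/
theorem bilin_fiberLift_long {σ : Type*} [DecidableEq κ] [DecidableEq σ] {K : ι → κ → ℂ} {W : Finset ι}
    {Z : Finset κ} {X : ℝ} (c : κ → ℝ) (hc : ∀ z ∈ Z, 0 ≤ c z)
    (h : BilinBoundedBy (fun w z => ((c z : ℝ) : ℂ) * K w z) W Z X) (F : κ → Finset σ)
    (hF : ∀ z ∈ Z, ((F z).card : ℝ) ≤ c z) :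
    BilinBoundedBy (fun w (p : κ × σ) => K w p.1) W (Z.biUnion fun z => (F z).image fun s => (z, s)) X :=
  bilin_swap (bilin_fiberLift (K := fun z w => K w z) c hc (bilin_swap h) F hF)

/-- **A down-set of `[L, N]` is an initial segment.** If `Q` is antitone on `[L, N]` (`L ≥ 1`), then for
`d ∈ [L, N]`: `Q d ↔ d ≤ L - 1 + #{d' ∈ [L, N] : Q d'}`. [folklore] -/
theorem iff_le_card_of_downset {L N : ℕ} (hL : 1 ≤ L) (Q : ℕ → Prop) [DecidablePred Q]
    (hQ : ∀ d d' : ℕ, L ≤ d' → d' ≤ d → d ≤ N → Q d → Q d') {d : ℕ} (hd : d ∈ Icc L N) :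
    Q d ↔ d ≤ L - 1 + ((Icc L N).filter Q).card := by
  rw [Finset.mem_Icc] at hd
  obtain ⟨hLd, hdN⟩ := hd
  constructor
  · intro hQd
    have hsub : Icc L d ⊆ (Icc L N).filter Q := by
      intro d' hd'
      rw [Finset.mem_Icc] at hd'
      rw [Finset.mem_filter, Finset.mem_Icc]
      exact ⟨⟨hd'.1, hd'.2.trans hdN⟩, hQ d d' hd'.1 hd'.2 hdN hQd⟩
    have hcard := Finset.card_le_card hsub
    rw [Nat.card_Icc] at hcard
    omega
  · intro hle
    by_contra hQd
    have hsub : (Icc L N).filter Q ⊆ Icc L (d - 1) := by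
      intro d' hd'
      rw [Finset.mem_filter, Finset.mem_Icc] at hd'
      rw [Finset.mem_Icc]
      refine ⟨hd'.1.1, ?_⟩
      by_contra hlt
      push Not at hlt
      exact hQd (hQ d' d hLd (by omega) hd'.1.2 hd'.2)
    have hcard := Finset.card_le_card hsub
    rw [Nat.card_Icc] at hcard
    omega

/-- **One ANTITONE (down-set) condition in the integer short variable is an integer threshold** (Ford–Maynard
Lemma 7.9): if every bilinear form in `K` over `W × Z` with `1`-bounded coefficients is `≤ X`, `W ⊆ [L, N]`
(`L ≥ 1`), and for each `z ∈ Z` the condition `Q · z` is a down-set of `[L, N]`, then every bilinear form in the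
kernel `[Q d z] K(d, z)` is `≤ 3(1 + log(2N+4)) X`. [cite: FordMaynard2024PrimeSieves, Lemma 7.9] -/
theorem bilin_sep_downset {K : ℕ → κ → ℂ} {W : Finset ℕ} {Z : Finset κ} {X : ℝ}
    (h : BilinBoundedBy K W Z X) {L N : ℕ} (hL : 1 ≤ L) (hW : W ⊆ Icc L N)
    (Q : ℕ → κ → Prop) [∀ d z, Decidable (Q d z)]
    (hQ : ∀ z ∈ Z, ∀ d d' : ℕ, L ≤ d' → d' ≤ d → d ≤ N → Q d z → Q d' z) :
    BilinBoundedBy (fun d z => (if Q d z then (1 : ℂ) else 0) * K d z) W Z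
      (3 * (1 + Real.log (2 * (N + 1 : ℕ) + 2)) * X) := by
  classical
  set G : κ → ℕ := fun z => min N (L - 1 + ((Icc L N).filter (fun d => Q d z)).card) with hG
  have h' := bilin_threshold_nat_le' h (fun d => d) G (N := N)
    (fun d hd => (Finset.mem_Icc.mp (hW hd)).2) (fun z _ => by simp only [hG]; exact min_le_left _ _)
  refine h'.congr fun d hd z hz => ?_
  have hdI := hW hd
  have hdN : d ≤ N := (Finset.mem_Icc.mp hdI).2
  have hiff : d ≤ G z ↔ Q d z := by
    rw [iff_le_card_of_downset hL (fun d => Q d z) (fun a b h1 h2 h3 h4 => hQ z hz a b h1 h2 h3 h4) hdI]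
    simp only [hG, le_min_iff]
    exact ⟨fun h => h.2, fun h => ⟨hdN, h⟩⟩
  simp only [hiff]

/-- **One MONOTONE (up-set) condition in the integer short variable is an integer threshold** (Ford–Maynard
Lemma 7.9): as `bilin_sep_downset`, for conditions `Q · z` that are up-sets of `[L, N]` (final segments
`{G(z) < d}`). [cite: FordMaynard2024PrimeSieves, Lemma 7.9] -/
theorem bilin_sep_upset {K : ℕ → κ → ℂ} {W : Finset ℕ} {Z : Finset κ} {X : ℝ}
    (h : BilinBoundedBy K W Z X) {L N : ℕ} (hL : 1 ≤ L) (hW : W ⊆ Icc L N)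
    (Q : ℕ → κ → Prop) [∀ d z, Decidable (Q d z)]
    (hQ : ∀ z ∈ Z, ∀ d d' : ℕ, L ≤ d → d ≤ d' → d' ≤ N → Q d z → Q d' z) :
    BilinBoundedBy (fun d z => (if Q d z then (1 : ℂ) else 0) * K d z) W Z
      (3 * (1 + Real.log (2 * (N + 1 : ℕ) + 2)) * X) := by
  classical
  set G : κ → ℕ := fun z => min N (L - 1 + ((Icc L N).filter (fun d => ¬ Q d z)).card) with hG
  have h' := bilin_threshold_nat h (fun d => d) G (N := N + 1)
    (fun d hd => ((Finset.mem_Icc.mp (hW hd)).2).trans (Nat.le_succ N))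
    (fun z _ => by simp only [hG]; exact (min_le_left _ _).trans (Nat.le_succ N))
  refine h'.congr fun d hd z hz => ?_
  have hdI := hW hd
  have hdN : d ≤ N := (Finset.mem_Icc.mp hdI).2
  have hanti : ∀ a b : ℕ, L ≤ b → b ≤ a → a ≤ N → ¬ Q a z → ¬ Q b z :=
    fun a b h1 h2 h3 h4 hb => h4 (hQ z hz b a h1 h2 h3 hb)
  have hiff : G z < d ↔ Q d z := by
    have := iff_le_card_of_downset hL (fun d => ¬ Q d z) hanti hdI
    rw [← not_iff_not, not_lt]
    rw [this]
    simp only [hG, le_min_iff]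
    exact ⟨fun h => h.2, fun h => ⟨hdN, h⟩⟩
  simp only [hiff]

/-- `𝟙[∀ i ∈ s, Q i] = ∏_{i ∈ s} 𝟙[Q i]` (as complex numbers). [folklore] -/
theorem ite_forall_finset_eq_prod {σ : Type*} (s : Finset σ) (Q : σ → Prop) [DecidablePred Q] :
    (if (∀ i ∈ s, Q i) then (1 : ℂ) else 0) = ∏ i ∈ s, if Q i then (1 : ℂ) else 0 :=
  (Finset.prod_boole).symm

/-- **A finite product of monotone / antitone conditions** (Ford–Maynard Lemma 7.11 in the integer case — the
iteration of Lemma 7.9): if every bilinear form in `K` over `W × Z` with `1`-bounded coefficients is `≤ X`,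
`W ⊆ [L, N]` (`L ≥ 1`), and each condition `Q i · z` (`i ∈ s`) is, for every `z ∈ Z`, a down-set or an up-set of
`[L, N]` in the short variable, then every bilinear form in the kernel `(∏_{i ∈ s} [Q i d z]) K(d, z)` is
`≤ (3(1 + log(2N+4)))^{#s} X` — no shell terms, no sign or size hypothesis on `K`.
[cite: FordMaynard2024PrimeSieves, Lemma 7.11 (integer thresholds, via Lemma 7.9)] -/
theorem bilin_sep_finset {σ : Type*} [DecidableEq σ] (s : Finset σ) {K : ℕ → κ → ℂ} {W : Finset ℕ}
    {Z : Finset κ} {X : ℝ} {L N : ℕ} (hL : 1 ≤ L) (hW : W ⊆ Icc L N)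
    (Q : σ → ℕ → κ → Prop) [∀ i d z, Decidable (Q i d z)]
    (hQ : ∀ i ∈ s,
      (∀ z ∈ Z, ∀ d d' : ℕ, L ≤ d' → d' ≤ d → d ≤ N → Q i d z → Q i d' z) ∨
      (∀ z ∈ Z, ∀ d d' : ℕ, L ≤ d → d ≤ d' → d' ≤ N → Q i d z → Q i d' z))
    (h : BilinBoundedBy K W Z X) :
    BilinBoundedBy (fun d z => (∏ i ∈ s, if Q i d z then (1 : ℂ) else 0) * K d z) W Z
      ((3 * (1 + Real.log (2 * (N + 1 : ℕ) + 2))) ^ s.card * X) := by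
  classical
  induction s using Finset.induction_on with
  | empty =>
    refine (h.congr fun d _ z _ => ?_).mono (le_of_eq ?_)
    · simp
    · simp
  | insert i s hi ih =>
    have ih' := ih (fun j hj => hQ j (Finset.mem_insert_of_mem hj))
    have step : BilinBoundedBy
        (fun d z => (if Q i d z then (1 : ℂ) else 0) *
          ((∏ j ∈ s, if Q j d z then (1 : ℂ) else 0) * K d z)) W Z
        (3 * (1 + Real.log (2 * (N + 1 : ℕ) + 2)) *
          ((3 * (1 + Real.log (2 * (N + 1 : ℕ) + 2))) ^ s.card * X)) := by
      rcases hQ i (Finset.mem_insert_self i s) with hanti | hmono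
      · exact bilin_sep_downset ih' hL hW (Q i) hanti
      · exact bilin_sep_upset ih' hL hW (Q i) hmono
    refine (step.congr fun d _ z _ => ?_).mono (le_of_eq ?_)
    · rw [Finset.prod_insert hi]; ring
    · rw [Finset.card_insert_of_notMem hi, pow_succ]; ring

end Summit.Parity.GeneralizedHardyLittlewood.FordMaynardSieveConst01651SieveConst01651
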